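import Mathlib.Analysis.SpecialFunctions.Pow.Deriv
import Mathlib.Analysis.SpecialFunctions.Pow.Continuity
import Literature.NumberTheory.Transcendental.KZCalculusProofs

/-!
# `CompleteModGammaSector` (stmt-KontsevichZagierPeriods-14233), line `cusp-transport-to-the-beta-world`:
# stub `stub_elliottCertificate` — the divergence certificate ∂_sF = ∂_tP + ∂_uQ of the Elliott family

Support file (`--supports stmt-KontsevichZagierPeriods-14233`) for the registered stub `stub_elliottCertificate` of the line lead's
skeleton `Cruxes/CompleteModGammaSector/Lines/cusp-transport-to-the-beta-world.lean`. Notation (functions of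
`z : Fin 3 → ℝ`, `t = z 0`, `u = z 1`, `s = z 2`; rational `0 < a < 1`, `1 - a < c`; real algebraic modulus
`z₁ ∈ (0,1)`): family `F = t^{-a}(1-t)^{c+a-2}(1-st)^{-a} · u^{-a}(1-u)^{c+a-2}(1-(1-s)u)^{-a} · (1 - st - (1-s)u)`
(Elliott–Legendre combination in Euler form, AQVV 2000 Cor. 3.13 (5); `a = 1/2`, `c = 1` is Legendre's relation),
potentials `P = t^{1-a}(1-t)^{c+a-1}(1-st)^{-a} · u^{1-a}(1-u)^{c+a-2}(1-(1-s)u)^{-a}`,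
`Q = -t^{1-a}(1-t)^{c+a-2}(1-st)^{-a} · u^{1-a}(1-u)^{c+a-1}(1-(1-s)u)^{-a}`, certificate `∂_sF = ∂_tP + ∂_uQ`.

References: M. Kontsevich, D. Zagier, *Periods* (2001), §1.2; G. D. Anderson, S.-L. Qiu, M. K. Vamanamurthy,
M. Vuorinen, *Generalized elliptic integrals and modular equations*, Pacific J. Math. 192 (2000), Cor. 3.13 (5);
G. E. Andrews, R. Askey, R. Roy, *Special Functions* (1999), Thm 3.2.8.
-/

noncomputable section

-- `Summit.KontsevichZagierPeriods.KontsevichZagierPeriods.…` is the tree's mandated layout (single-conjunct summit).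
set_option linter.dupNamespace false

namespace Summit.KontsevichZagierPeriods.KontsevichZagierPeriods.CompleteModGammaSectorCuspLine

open MeasureTheory Set
open Literature.NumberTheory.Transcendental

/-- The fibre point `Fin.snoc x s : Fin 3 → ℝ` has first coordinate `x 0`. -/
private lemma snoc_fin3_zero (x : Fin 2 → ℝ) (s : ℝ) : (Fin.snoc x s : Fin 3 → ℝ) 0 = x 0 := rfl

/-- The fibre point `Fin.snoc x s : Fin 3 → ℝ` has second coordinate `x 1`. -/
private lemma snoc_fin3_one (x : Fin 2 → ℝ) (s : ℝ) : (Fin.snoc x s : Fin 3 → ℝ) 1 = x 1 := rfl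

/-- The fibre point `Fin.snoc x s : Fin 3 → ℝ` has last coordinate `s`. -/
private lemma snoc_fin3_two (x : Fin 2 → ℝ) (s : ℝ) : (Fin.snoc x s : Fin 3 → ℝ) 2 = s := rfl

/-- The divergence certificate `∂_sF = ∂_tP + ∂_uQ` of the Elliott family, in coordinates: for real
exponents `a, c` and nonzero bases `t, u, 1 - s t, 1 - (1 - s) u`, the `s`-derivative of
`F = t^{-a}(1-t)^{c+a-2}(1-st)^{-a} · u^{-a}(1-u)^{c+a-2}(1-(1-s)u)^{-a} · (1 - st - (1-s)u)`
is `∂_tP + ∂_uQ` (a polynomial identity after splitting off one power of each moving base). -/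
private lemma hasDerivAt_elliott_family (a c t u s : ℝ) (ht : t ≠ 0) (hu : u ≠ 0)
    (hA : 1 - s * t ≠ 0) (hB : 1 - (1 - s) * u ≠ 0) :
    HasDerivAt (fun s : ℝ => t ^ (-a) * (1 - t) ^ (c + a - 2) * (1 - s * t) ^ (-a) *
        (u ^ (-a) * (1 - u) ^ (c + a - 2) * (1 - (1 - s) * u) ^ (-a)) * (1 - s * t - (1 - s) * u))
      (t ^ (-a) * (1 - t) ^ (c + a - 2) * (1 - s * t) ^ (-a - 1) *
          ((1 - a) * (1 - t) * (1 - s * t) - (c + a - 1) * t * (1 - s * t) + a * s * t * (1 - t)) *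
          (u ^ (1 - a) * (1 - u) ^ (c + a - 2) * (1 - (1 - s) * u) ^ (-a)) +
        -(t ^ (1 - a) * (1 - t) ^ (c + a - 2) * (1 - s * t) ^ (-a) *
          (u ^ (-a) * (1 - u) ^ (c + a - 2) * (1 - (1 - s) * u) ^ (-a - 1) *
            ((1 - a) * (1 - u) * (1 - (1 - s) * u) - (c + a - 1) * u * (1 - (1 - s) * u) +
              a * (1 - s) * u * (1 - u))))) s := by
  -- the two moving bases `1 - s t` and `1 - (1 - s) u` and the linear factor
  have hAd : HasDerivAt (fun s : ℝ => 1 - s * t) (-(1 * t)) s :=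
    ((hasDerivAt_id' s).mul_const t).const_sub 1
  have hBi : HasDerivAt (fun s : ℝ => (1 - s) * u) (-1 * u) s :=
    ((hasDerivAt_id' s).const_sub 1).mul_const u
  have hBd : HasDerivAt (fun s : ℝ => 1 - (1 - s) * u) (-(-1 * u)) s := hBi.const_sub 1
  have hL : HasDerivAt (fun s : ℝ => 1 - s * t - (1 - s) * u) (-(1 * t) - -1 * u) s := hAd.sub hBi
  -- the two kernels `k_t`, `k_u`
  have hkt : HasDerivAt (fun s : ℝ => t ^ (-a) * (1 - t) ^ (c + a - 2) * (1 - s * t) ^ (-a))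
      (t ^ (-a) * (1 - t) ^ (c + a - 2) * (-(1 * t) * (-a) * (1 - s * t) ^ (-a - 1))) s :=
    (hAd.rpow_const (Or.inl hA)).const_mul _
  have hku : HasDerivAt (fun s : ℝ => u ^ (-a) * (1 - u) ^ (c + a - 2) * (1 - (1 - s) * u) ^ (-a))
      (u ^ (-a) * (1 - u) ^ (c + a - 2) * (-(-1 * u) * (-a) * (1 - (1 - s) * u) ^ (-a - 1))) s :=
    (hBd.rpow_const (Or.inl hB)).const_mul _
  refine ((hkt.fun_mul hku).fun_mul hL).congr_deriv ?_
  -- split one power off each moving base and off `t ^ (1 - a)`, `u ^ (1 - a)`; then it is `ring`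
  have eA : (1 - s * t) ^ (-a) = (1 - s * t) ^ (-a - 1) * (1 - s * t) := by
    rw [← Real.rpow_add_one hA, sub_add_cancel]
  have eB : (1 - (1 - s) * u) ^ (-a) = (1 - (1 - s) * u) ^ (-a - 1) * (1 - (1 - s) * u) := by
    rw [← Real.rpow_add_one hB, sub_add_cancel]
  have eT : t ^ (1 - a) = t ^ (-a) * t := by rw [← Real.rpow_add_one ht, neg_add_eq_sub]
  have eU : u ^ (1 - a) = u ^ (-a) * u := by rw [← Real.rpow_add_one hu, neg_add_eq_sub]
  rw [eA, eB, eT, eU]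
  ring

/-- Stub `stub_elliottCertificate` of line `cusp-transport-to-the-beta-world` (the divergence certificate ∂_sF = ∂_tP + ∂_uQ of the Elliott family). [cite: KontsevichZagier2001, §1.2] -/
theorem stub_elliottCertificate : ∀ (a c : ℚ) (z₁ : ℝ), 0 < a → a < 1 → 1 - a < c → 0 < z₁ → z₁ < 1 → IsAlgebraic ℚ z₁ →
    ∀ x : Fin 2 → ℝ, (∀ i, x i ∈ Set.Ioo (0:ℝ) 1) →
      ContinuousOn (fun s : ℝ => (fun z : Fin 3 → ℝ => (z 0) ^ (-(a : ℝ)) * (1 - z 0) ^ ((c : ℝ) + (a : ℝ) - 2) * (1 - z 2 * z 0) ^ (-(a : ℝ)) * ((z 1) ^ (-(a : ℝ)) * (1 - z 1) ^ ((c : ℝ) + (a : ℝ) - 2) * (1 - (1 - z 2) * z 1) ^ (-(a : ℝ))) * (1 - z 2 * z 0 - (1 - z 2) * z 1)) (Fin.snoc x s)) (Set.Icc (0:ℝ) z₁) ∧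
      ∀ s ∈ Set.Ioo (0:ℝ) z₁, HasDerivAt (fun u : ℝ => (fun z : Fin 3 → ℝ => (z 0) ^ (-(a : ℝ)) * (1 - z 0) ^ ((c : ℝ) + (a : ℝ) - 2) * (1 - z 2 * z 0) ^ (-(a : ℝ)) * ((z 1) ^ (-(a : ℝ)) * (1 - z 1) ^ ((c : ℝ) + (a : ℝ) - 2) * (1 - (1 - z 2) * z 1) ^ (-(a : ℝ))) * (1 - z 2 * z 0 - (1 - z 2) * z 1)) (Fin.snoc x u))
        ((fun z : Fin 3 → ℝ => (z 0) ^ (-(a : ℝ)) * (1 - z 0) ^ ((c : ℝ) + (a : ℝ) - 2) * (1 - z 2 * z 0) ^ (-(a : ℝ) - 1) * ((1 - (a : ℝ)) * (1 - z 0) * (1 - z 2 * z 0) - ((c : ℝ) + (a : ℝ) - 1) * z 0 * (1 - z 2 * z 0) + (a : ℝ) * z 2 * z 0 * (1 - z 0)) * ((z 1) ^ (1 - (a : ℝ)) * (1 - z 1) ^ ((c : ℝ) + (a : ℝ) - 2) * (1 - (1 - z 2) * z 1) ^ (-(a : ℝ)))) (Fin.snoc x s) +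
         (fun z : Fin 3 → ℝ => -((z 0) ^ (1 - (a : ℝ)) * (1 - z 0) ^ ((c : ℝ) + (a : ℝ) - 2) * (1 - z 2 * z 0) ^ (-(a : ℝ)) * ((z 1) ^ (-(a : ℝ)) * (1 - z 1) ^ ((c : ℝ) + (a : ℝ) - 2) * (1 - (1 - z 2) * z 1) ^ (-(a : ℝ) - 1) * ((1 - (a : ℝ)) * (1 - z 1) * (1 - (1 - z 2) * z 1) - ((c : ℝ) + (a : ℝ) - 1) * z 1 * (1 - (1 - z 2) * z 1) + (a : ℝ) * (1 - z 2) * z 1 * (1 - z 1))))) (Fin.snoc x s)) s := by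
  intro a c z₁ _ _ _ _ hz₁ _ x hx
  obtain ⟨ht0, ht1⟩ := hx 0
  obtain ⟨hu0, hu1⟩ := hx 1
  -- on the closed band `0 ≤ s ≤ z₁ < 1` every base is positive, so `F` is its own `C¹` primitive
  have key : ∀ s : ℝ, 0 ≤ s → s < 1 →
      0 < 1 - s * x 0 ∧ 0 < 1 - (1 - s) * x 1 := fun s hs0 hs1 =>
    ⟨by nlinarith [mul_nonneg hs0 (sub_nonneg.2 ht1.le)], by nlinarith [mul_nonneg hs0 hu0.le]⟩
  refine ⟨fun s hs => ?_, fun s hs => ?_⟩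
  · obtain ⟨hA, hB⟩ := key s hs.1 (hs.2.trans_lt hz₁)
    have h := (hasDerivAt_elliott_family (a : ℝ) (c : ℝ) (x 0) (x 1) s ht0.ne' hu0.ne' hA.ne' hB.ne').continuousAt
    refine ContinuousAt.continuousWithinAt ?_
    simpa only [snoc_fin3_zero, snoc_fin3_one, snoc_fin3_two] using h
  · obtain ⟨hA, hB⟩ := key s hs.1.le (hs.2.trans hz₁)
    have h := hasDerivAt_elliott_family (a : ℝ) (c : ℝ) (x 0) (x 1) s ht0.ne' hu0.ne' hA.ne' hB.ne'
    simpa only [snoc_fin3_zero, snoc_fin3_one, snoc_fin3_two] using h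

end Summit.KontsevichZagierPeriods.KontsevichZagierPeriods.CompleteModGammaSectorCuspLine
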